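import Literature.MathematicalPhysics.QuantumFieldTheory.Balaban1983to89.B13GreenCentreDecayOfCoercive
import Literature.MathematicalPhysics.QuantumFieldTheory.Balaban1983to89.B9Thm311PosViaLocalInversesY

/-!
# `Balaban1983to89.B13CoerciveOfInverseFormBound` — T. Bałaban, *Propagators for lattice gauge theories in a background field*, Commun. Math. Phys. **99**
# (1985) 389–434 [Balaban1985BackgroundPropagators], (3.26)–(3.27) p. 395 («Δ_a = Δ + DRD* + Q*aQ», «G(U) = G = (Δ_a|Ω₀)⁻¹»), Thm 3.3 p. 399 («the operator G(U)
# (a = 1) satisfies the inequalities (3.42)–(3.47), with G′(U) replaced by G(U)»), (3.46)–(3.47) p. 398 («Finally, we have the inequalities in L²-norms … and the global inequalities |G′(U)λ|, … ≦ B₀ …»), Thm 3.10 (3.107)–(3.108) p. 416, Thm 3.11 p. 416 («the operators Δ′_a, G′, (Q′G′²Q′*)⁻¹, Δ_a, G are positive definite … From (3.108) it follows that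
# the expansion (3.107) is convergent in all norms in the inequalities (3.42)–(3.47). This implies Theorem 3.3»); [4] = *Propagators … II*, Commun. Math. Phys.
# **96** (1984) 223–250 [Balaban1984PropagatorsII] p. 226 («the operator Δ_a is bounded from below by a positive constant, hence … G = Δ_a⁻¹»):
# ★★★ THE QUANTITATIVE COERCIVITY OF `Δ_a(U₀)` FROM PRINT's TWO VERBATIM STATEMENTS — Theorem 3.11's clause «Δ_a positive definite» (the N06
# certificate's row 17) and Theorem 3.3's global bound for `G(U₀) = Δ_a(U₀)⁻¹` — its L² inequalities (3.46) summed by [4] Lemma 2.1, resp. the global inequalities (3.47) — read as ONE L²-form bound — by a finite-dimensional form device;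
# hence the N10 lane's located G-junction with its ONE displayed analytic sentence in print's own currency.

[folklore] finite-dimensional form algebra (a Cauchy–Schwarz inequality for the form of a symmetric nonnegative operator, by the discriminant) + the tree's
weighted trace coordinates `B9Thm311ReadingCoords.realify311` + compositions of cited tree theorems BY NAME; THEOREMS ONLY (no `def`, no `structure`, no
instance, no notation); NOTHING of NODE 00's ∕ N06's is modified or restated; nothing here is a claim about the Yang–Mills mass gap; no node is discharged;
count-neutral.

WHY THIS FILE (cell `pub-ymgap`, HUMAN RULING D-0062, Track A node N10 = [B13] = [Balaban1988RG2Cluster]; seat `pub-ymgap-dag-n10-c` g16, the N10 LANE OWNER,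
CLAIM-1 ∕ INTENT-1 2026-08-28).  The lane's census v19 («What would move N10 next», item 1) records that, after the width seats' located editions of the v4
inverse road `G′ → X⁻¹ → R → Δ_a → G` on the regular class (3.35), the ONLY analytic sentence of N06's the road still displays for print's last inverse
`G = Δ_a⁻¹` is EITHER row 17's qualitative clause `PosDefTr 1 (Δ_a(U₀))` (n10-w2 g3's `B13GreenCentreDecayOfCoercive.exists_…_of_posDefTr`: letters of `G`
along pv27's pencil at SOME rate and radius) OR the lane's LOCATED-ASK to N06 (INBOX l.30423): the QUANTITATIVE coercivity
`hco : m·⟨Ψ,Ψ⟩₁ ≤ ⟨Ψ, Δ_a(U₀)Ψ⟩₁` with a located `m` (`…_located_of_coercive_flat`: located rate, radius, constant) — a sentence print never states in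
this form (the N06 bundle-F5 seat's close note, INBOX l.36844: «QUANTITATIVE coercivity … L, analytic, unowned»).  THIS FILE observes that print DOES state it,
in two pieces whose conjunction is equivalent: Theorem 3.11 («Δ_a, G are positive definite», p. 416 — whose printed proof DERIVES positivity from the
convergent expansion (3.107)–(3.108)) and Theorem 3.3's global bound for `G` (the L² inequalities (3.46) «‖hG(U)λ‖ ≦ B₀(Lʲη)²…‖λ‖» summed over the localisations by [4] Lemma 2.1, resp.
the global inequalities (3.47); here read as the ONE L²-form bound `⟨Φ, G(U₀)Φ⟩₁ ≤ B·⟨Φ,Φ⟩₁` they deliver by Cauchy–Schwarz).  For a trIP-symmetric positive definite `T` whose inverse has the form bound `B`, the form of `T`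
is bounded below by `B⁻¹` (§1) — so the located `m` the lane asked for is `m = B⁻¹` with `B` the global L² constant Theorem 3.3 gives for `G`, and the N10 side needs from N06
NOTHING beyond its two printed theorems, verbatim.  §3 feeds this into n10-w2 g3's located G-junction.

WHAT THIS FILE PROVES (all `theorem`s).
* §1 (ANY real inner product space; private helpers) `inner_sq_le_of_symm_of_nonneg` — Cauchy–Schwarz for the form `⟪x, A y⟫` of a symmetric ℝ-linear `A` with
  `0 ≤ ⟪x, A x⟫`: `⟪x, A y⟫² ≤ ⟪x, A x⟫·⟪y, A y⟫` (discriminant of `t ↦ ⟪x − t y, A(x − t y)⟫`); `inner_sq_le_of_symm_of_nonneg_chart` (the same for a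
  ℂ-linear `A` read through a real-linear chart `e`, via the tree's `conj311` picture).
* §1′ (ANY finite index types `S, n`, any positive weight `w`; print's weighted trace pairing `trIP w` of `B9Thm311ReadingCoords`) `trIP_comm`;
  `sq_trIP_le_of_isSymmTr_of_nonneg` (§1 through `realify311`); `isSymmTr_of_two_sided_inverse` (a two-sided inverse of a trIP-symmetric operator is
  trIP-symmetric); `trIP_inverse_self_nonneg` (… and its form is nonnegative when the operator's is); ★ `coer_of_isSymmTr_of_inverse_formBound`: `T`
  trIP-symmetric with `0 ≤ ⟨Φ,TΦ⟩_w`, `Ti` a two-sided inverse with `⟨Φ, TiΦ⟩_w ≤ B·⟨Φ,Φ⟩_w`, `0 < B` ⟹ `B⁻¹·⟨Ψ,Ψ⟩_w ≤ ⟨Ψ,TΨ⟩_w` for every `Ψ`;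
  ★ `coer_of_isSymmTr_posDefTr_of_ringInverse_formBound`: the same with `Ti := Ring.inverse T` and `PosDefTr w T` (two-sidedness from the tree's
  `isUnit_of_posDefTr`) — «positive definite» + «the inverse is bounded by B» ⟹ «bounded from below by the positive constant B⁻¹» ([4] p. 226's sentence,
  quantitatively).
* §2 (NODE 00's bond sector at def-Y's v4 letters `parSymY ∕ parBY ∕ G′ = GpY parSymY`, fibre `M_N(ℂ)`, `G ≤ U(N)`, `G`-valued `U₀`)
  ★★ `trIP_deltaAY_parSymY_ge_of_posDefTr_of_GAY_formBound`: row 17's clause `PosDefTr 1 (Δ_a(U₀))` + the (3.46)–(3.47)-type global L²-form bound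
  `⟨Φ, G(U₀)Φ⟩₁ ≤ B·⟨Φ,Φ⟩₁` (`0 < B`) ⟹ `B⁻¹·⟨Ψ,Ψ⟩₁ ≤ ⟨Ψ, Δ_a(U₀)Ψ⟩₁` — the lane's `hco` with `m = B⁻¹`; symmetry of `Δ_a(U₀)` is the N06 lineage's theorem
  `B9Thm311PosViaLocalInversesY.deltaAY_parSymY_isSymmTr` (by name).
* §3 ★★★ `rawEntryLetters_toMatrix_GAY_parSymY_prodCfg_located_of_posDefTr_of_formBound` — n10-w2 g3's located G-junction
  `B13GreenCentreDecayOfCoercive.rawEntryLetters_toMatrix_GAY_prodCfg_located_of_coercive_flat` at the v4 letters with its displayed `(m, hm, hco)` SUPPLIED by §2: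
  from Δ_a's pencil letters `hA` (the junction's own datum), row 17's clause, the form bound `B` of `G(U₀)`, a fibre bound `m_F` of the location map and the
  Combes–Thomas window (`0 ≤ κ ≤ ρ∕4`, `8·B_Δ·κ·(m_F c₀(1,ρ∕2)^ν) ≤ B⁻¹ρ`, `0 ≤ ρ′ < κ`):
  `RawEntryLetters (A′ ↦ toMatrix B′ B′ (G(e^{iηA′}U₀))) loc (R∕(4·B_Δ·(4B)·(m_F c₀(1,(κ−ρ′)∕3)^ν)² + 1)) ρ′ (2·(4B))` — LOCATED rate, radius and constant, versus
  the `∃κ ∃R₁` of `…_of_posDefTr`; N06 content = Theorem 3.11's clause + Theorem 3.3's (3.46)–(3.47) for `G`, both at the one real background `U₀`, nothing else.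

HONEST FRAMING: [folklore] bookkeeping + compositions; `hpd` (Theorem 3.11 for `Δ_a(U₀)`) and `hGB` (Theorem 3.3's (3.46)–(3.47) for `G(U₀)`) are DISPLAYED — N06's
theorems on the class (3.35), NOT proved here and NOT claimed; the LOCAL cube clause of print's p. 416 road (n06-j's files) is untouched; print's multi-scale
rate (3.42) is NOT claimed — the rate is whatever `(B; B_Δ, ρ, m_F)` allow; finite-lattice constants, not print's `O(1)`; nothing of Bałaban's asserted beyond the
cited theorems; N06 ∕ N10 NOT discharged; K1⁹ NOT closed; counts unmoved (typed 28∕28 · discharged 5∕27); 0 `def`, 0 `sorry`, standard axioms; one finite 𝕋⁴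
programme at fixed ε — R4 closes the conditional finite-𝕋⁴ rung `BalabanLadder.UV` only; the YM mass gap (Clay) is NOT proved by any of this; nothing
continuum ∕ ℝ⁴ ∕ OS.  Filed `--kind proof --supports` K1⁹ «StabilityBRunRowsAtRecordR13SepCoPHV» (stmt-QuantumFields-27364), Literature lane.

References: T. Bałaban, CMP 99 (1985) 389–434 [Balaban1985BackgroundPropagators] (3.26)–(3.27) p.395, (3.34) p.396, (3.35) p.396, Thm 3.3 p.399, (3.42)–(3.47)
pp.397–398, Thm 3.4 p.400, (3.84)–(3.86) p.407, Thm 3.10 (3.107)–(3.108) pp.415–416, Thm 3.11 p.416; CMP 96 (1984) 223–250 [Balaban1984PropagatorsII] (2.19),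
p.226, Lemma 2.1 (2.61) p.234; CMP 116 (1988) 1–22 [Balaban1988RG2Cluster] (2.5)–(2.7) pp.12–13, p.15; M. Aizenman, S. Warzel, *Random operators* (2015)
[AizenmanWarzel2015] §10.3 (Combes–Thomas).
-/

noncomputable section

namespace Literature.MathematicalPhysics.QuantumFieldTheory.Balaban1983to89.B13CoerciveOfInverseFormBound

open Metric Set Finset Module
open scoped Matrix Matrix.Norms.L2Operator
open Literature.MathematicalPhysics.QuantumFieldTheory.Balaban1983to89
open Literature.MathematicalPhysics.QuantumFieldTheory.Balaban1983to89.B9Thm37GlueTorus (tdist1)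
open Literature.MathematicalPhysics.QuantumFieldTheory.Balaban1983to89.B5TorusCover (UT)
open Literature.MathematicalPhysics.QuantumFieldTheory.Balaban1983to89.B9Thm311ReadingCoords
  (trIP PosDefTr IsSymmTr realify311 conj311 symm_conj311_iff inner_realify311 norm_sq_realify311 isUnit_of_posDefTr
    apply_inverse_of_isUnit inverse_apply_of_isUnit)
open Literature.MathematicalPhysics.QuantumFieldTheory.Balaban1983to89.B13EntrywiseWalks (RawEntryLetters)
open Literature.MathematicalPhysics.QuantumFieldTheory.Balaban1983to89.B13GreenCentreDecayOfCoercive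
  (rawEntryLetters_toMatrix_GAY_prodCfg_located_of_coercive_flat)
open Literature.MathematicalPhysics.QuantumFieldTheory.Balaban1983to89.B9Thm311PosViaLocalInversesY (deltaAY_parSymY_isSymmTr)
open Literature.MathematicalPhysics.QuantumFieldTheory.Balaban1983to89.B9Eq39Adjoint (prodCfg)
open Literature.MathematicalPhysics.QuantumFieldTheory.Balaban1983to89.B6GlobalChartV1 (PV)
open Literature.MathematicalPhysics.QuantumFieldTheory.Balaban1983to89.B6KLevelCensusIndexV1 (KIdx)
open Literature.MathematicalPhysics.QuantumFieldTheory.Balaban1983to89.Node00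

/-! ## §1. Cauchy–Schwarz for the form of a symmetric nonnegative operator (real inner product space) -/

section RealForm

variable {E : Type*} [NormedAddCommGroup E] [InnerProductSpace ℝ E]

/-- **CAUCHY–SCHWARZ FOR THE FORM OF A SYMMETRIC NONNEGATIVE OPERATOR**: for an ℝ-linear `A` with `⟪A x, y⟫ = ⟪x, A y⟫` and `0 ≤ ⟪x, A x⟫`,
`⟪x, A y⟫² ≤ ⟪x, A x⟫·⟪y, A y⟫` — the discriminant of the nonnegative quadratic `t ↦ ⟪x − t·y, A(x − t·y)⟫` (private helper). [folklore] -/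
private theorem inner_sq_le_of_symm_of_nonneg (A : E →ₗ[ℝ] E) (hsym : ∀ x y, inner ℝ (A x) y = inner ℝ x (A y))
    (hpos : ∀ x, 0 ≤ inner ℝ x (A x)) (x y : E) :
    inner ℝ x (A y) ^ 2 ≤ inner ℝ x (A x) * inner ℝ y (A y) := by
  have hyx : inner ℝ y (A x) = inner ℝ x (A y) := by rw [← hsym x y, real_inner_comm]
  have hq : ∀ t : ℝ, 0 ≤ inner ℝ y (A y) * (t * t) + (-(2 * inner ℝ x (A y))) * t + inner ℝ x (A x) := by
    intro t
    have h := hpos (x - t • y)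
    have hexp : inner ℝ (x - t • y) (A (x - t • y)) =
        inner ℝ y (A y) * (t * t) + (-(2 * inner ℝ x (A y))) * t + inner ℝ x (A x) := by
      rw [map_sub, map_smul, inner_sub_left, inner_sub_right, inner_sub_right, real_inner_smul_left, real_inner_smul_left,
        real_inner_smul_right, real_inner_smul_right, hyx]
      ring
    rwa [hexp] at h
  have hd := discrim_le_zero hq
  rw [discrim] at hd
  nlinarith [hd]

/-- the same read through a real-linear chart `e : X ≃ V` for a ℂ-linear `A` on `X` (the tree's `conj311` picture): symmetry and nonnegativity of the form
`⟪e x, e(A y)⟫` give `⟪e x, e(A y)⟫² ≤ ⟪e x, e(A x)⟫·⟪e y, e(A y)⟫` (private helper). [folklore] -/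
private theorem inner_sq_le_of_symm_of_nonneg_chart {X : Type*} [AddCommGroup X] [Module ℝ X] [Module ℂ X] [LinearMap.CompatibleSMul X X ℝ ℂ]
    (e : X ≃ₗ[ℝ] E) (A : X →ₗ[ℂ] X) (hsym : ∀ x y : X, inner ℝ (e (A x)) (e y) = inner ℝ (e x) (e (A y)))
    (hpos : ∀ x : X, 0 ≤ inner ℝ (e x) (e (A x))) (x y : X) :
    inner ℝ (e x) (e (A y)) ^ 2 ≤ inner ℝ (e x) (e (A x)) * inner ℝ (e y) (e (A y)) := by
  have hsym' : ∀ u v, inner ℝ (conj311 e e A u) v = inner ℝ u (conj311 e e A v) := (symm_conj311_iff e A).mpr hsym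
  have hpos' : ∀ u, 0 ≤ inner ℝ u (conj311 e e A u) := fun u => by simpa using hpos (e.symm u)
  simpa using inner_sq_le_of_symm_of_nonneg (conj311 e e A) hsym' hpos' (e x) (e y)

end RealForm

/-! ## §1′. The same in print's weighted trace currency; coercivity from a form bound on a two-sided inverse -/

section Trace

variable {S n : Type} [Fintype S] [Fintype n] {w : S → ℝ} (hw : ∀ s, 0 < w s)

/-- print's weighted real trace pairing is symmetric: `⟨Φ,Ψ⟩_w = ⟨Ψ,Φ⟩_w`. [cite: Balaban1985BackgroundPropagators, p.393 (scalar products); folklore] -/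
theorem trIP_comm (w : S → ℝ) (Φ Ψ : S → Matrix n n ℂ) : trIP w Φ Ψ = trIP w Ψ Φ := by
  simp only [trIP]
  refine Finset.sum_congr rfl fun s _ => ?_
  congr 1
  refine Finset.sum_congr rfl fun a _ => Finset.sum_congr rfl fun b _ => ?_
  simp only [Complex.mul_re, Complex.star_def, Complex.conj_re, Complex.conj_im]
  ring

include hw in
/-- **CAUCHY–SCHWARZ FOR THE FORM OF A trIP-SYMMETRIC NONNEGATIVE OPERATOR**: `IsSymmTr w A` and `0 ≤ ⟨Φ, AΦ⟩_w` give
`⟨Φ, AΨ⟩_w² ≤ ⟨Φ, AΦ⟩_w·⟨Ψ, AΨ⟩_w` (§1 read through the orthonormal coordinates `realify311`). [cite: Balaban1985BackgroundPropagators, p.393 (scalar products); folklore] -/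
theorem sq_trIP_le_of_isSymmTr_of_nonneg {A : (S → Matrix n n ℂ) →ₗ[ℂ] (S → Matrix n n ℂ)} (hsym : IsSymmTr w A)
    (hpos : ∀ Φ, 0 ≤ trIP w Φ (A Φ)) (Φ Ψ : S → Matrix n n ℂ) :
    trIP w Φ (A Ψ) ^ 2 ≤ trIP w Φ (A Φ) * trIP w Ψ (A Ψ) := by
  have h := inner_sq_le_of_symm_of_nonneg_chart (realify311 w hw) A
    (fun x y => by rw [inner_realify311, inner_realify311]; exact hsym x y)
    (fun x => by rw [inner_realify311]; exact hpos x) Φ Ψ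
  rwa [inner_realify311, inner_realify311, inner_realify311] at h

/-- a two-sided inverse `Ti` of a trIP-symmetric operator `T` is trIP-symmetric. [cite: Balaban1985BackgroundPropagators, Thm 3.11 p.416 («It is a symmetric and
invertible operator»); folklore] -/
theorem isSymmTr_of_two_sided_inverse {T Ti : (S → Matrix n n ℂ) →ₗ[ℂ] (S → Matrix n n ℂ)} (hsym : IsSymmTr w T)
    (hTi : ∀ Φ, T (Ti Φ) = Φ) : IsSymmTr w Ti := by
  intro Φ Ξ
  calc trIP w (Ti Φ) Ξ = trIP w (Ti Φ) (T (Ti Ξ)) := by rw [hTi]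
    _ = trIP w (T (Ti Φ)) (Ti Ξ) := (hsym _ _).symm
    _ = trIP w Φ (Ti Ξ) := by rw [hTi]

/-- … and its form is nonnegative when the operator's is: `0 ≤ ⟨Φ, TiΦ⟩_w`. [cite: Balaban1985BackgroundPropagators, Thm 3.11 p.416; folklore] -/
theorem trIP_inverse_self_nonneg {T Ti : (S → Matrix n n ℂ) →ₗ[ℂ] (S → Matrix n n ℂ)} (hpos : ∀ Φ, 0 ≤ trIP w Φ (T Φ))
    (hTi : ∀ Φ, T (Ti Φ) = Φ) (Φ : S → Matrix n n ℂ) : 0 ≤ trIP w Φ (Ti Φ) := by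
  have h := hpos (Ti Φ)
  rwa [hTi, trIP_comm] at h

include hw in
/-- ★ **COERCIVITY FROM A FORM BOUND ON THE INVERSE.**  `T` trIP-symmetric with nonnegative form, `Ti` a two-sided inverse of `T` whose form is bounded,
`⟨Φ, TiΦ⟩_w ≤ B·⟨Φ,Φ⟩_w` with `0 < B` ⟹ `B⁻¹·⟨Ψ,Ψ⟩_w ≤ ⟨Ψ, TΨ⟩_w` for every `Ψ`.  Proof: Cauchy–Schwarz for the form of `Ti` at `(Ψ, TΨ)` gives
`⟨Ψ,Ψ⟩² ≤ ⟨Ψ,TiΨ⟩·⟨TΨ,Ψ⟩ ≤ B⟨Ψ,Ψ⟩·⟨Ψ,TΨ⟩`.  (The converse — coercive ⟹ inverse bounded by the reciprocal — is the tree's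
`B9Thm311QuantAtLettersY.inverse_bounds_of_coercive`.) [cite: Balaban1985BackgroundPropagators, Thm 3.11 p.416, (3.46)–(3.47) p.398; Balaban1984PropagatorsII, p.226; folklore] -/
theorem coer_of_isSymmTr_of_inverse_formBound {T Ti : (S → Matrix n n ℂ) →ₗ[ℂ] (S → Matrix n n ℂ)} (hsym : IsSymmTr w T)
    (hpos : ∀ Φ, 0 ≤ trIP w Φ (T Φ)) (hTi : ∀ Φ, T (Ti Φ) = Φ) (hiT : ∀ Φ, Ti (T Φ) = Φ) {B : ℝ} (hB : 0 < B)
    (hform : ∀ Φ, trIP w Φ (Ti Φ) ≤ B * trIP w Φ Φ) (Ψ : S → Matrix n n ℂ) :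
    B⁻¹ * trIP w Ψ Ψ ≤ trIP w Ψ (T Ψ) := by
  have hcs := sq_trIP_le_of_isSymmTr_of_nonneg hw (isSymmTr_of_two_sided_inverse hsym hTi) (trIP_inverse_self_nonneg hpos hTi) Ψ (T Ψ)
  rw [hiT, trIP_comm w (T Ψ) Ψ] at hcs
  -- `hcs : ⟨Ψ,Ψ⟩² ≤ ⟨Ψ,TiΨ⟩·⟨Ψ,TΨ⟩`
  have hN : 0 ≤ trIP w Ψ Ψ := by rw [← norm_sq_realify311 (w := w) (hw := hw)]; positivity
  have hP : 0 ≤ trIP w Ψ (T Ψ) := hpos Ψ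
  have h2 : trIP w Ψ Ψ ^ 2 ≤ B * trIP w Ψ Ψ * trIP w Ψ (T Ψ) := hcs.trans (mul_le_mul_of_nonneg_right (hform Ψ) hP)
  have h3 : trIP w Ψ Ψ ≤ B * trIP w Ψ (T Ψ) := by
    rcases hN.eq_or_lt with hN0 | hNpos
    · rw [← hN0]; exact mul_nonneg hB.le hP
    · nlinarith
  calc B⁻¹ * trIP w Ψ Ψ ≤ B⁻¹ * (B * trIP w Ψ (T Ψ)) := mul_le_mul_of_nonneg_left h3 (inv_nonneg.mpr hB.le)
    _ = trIP w Ψ (T Ψ) := by rw [inv_mul_cancel_left₀ hB.ne']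

include hw in
/-- ★ **«POSITIVE DEFINITE» + «THE INVERSE IS BOUNDED BY B» ⟹ «BOUNDED FROM BELOW BY THE POSITIVE CONSTANT B⁻¹»** ([4] p. 226's sentence, quantitatively):
for a trIP-symmetric `PosDefTr` operator `T` (hence a unit, `isUnit_of_posDefTr`, with the two-sided inverse `Ring.inverse T`), a form bound
`⟨Φ, T⁻¹Φ⟩_w ≤ B·⟨Φ,Φ⟩_w`, `0 < B`, gives `B⁻¹·⟨Ψ,Ψ⟩_w ≤ ⟨Ψ, TΨ⟩_w`.
[cite: Balaban1985BackgroundPropagators, Thm 3.11 p.416, (3.46)–(3.47) p.398, (3.27) p.395; Balaban1984PropagatorsII, p.226; folklore] -/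
theorem coer_of_isSymmTr_posDefTr_of_ringInverse_formBound {T : Module.End ℂ (S → Matrix n n ℂ)} (hsym : IsSymmTr w T) (hpd : PosDefTr w T)
    {B : ℝ} (hB : 0 < B) (hform : ∀ Φ, trIP w Φ (Ring.inverse T Φ) ≤ B * trIP w Φ Φ) (Ψ : S → Matrix n n ℂ) :
    B⁻¹ * trIP w Ψ Ψ ≤ trIP w Ψ (T Ψ) := by
  have hU : IsUnit T := isUnit_of_posDefTr hpd
  have hpos : ∀ Φ, 0 ≤ trIP w Φ (T Φ) := by
    intro Φ
    by_cases h : Φ = 0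
    · subst h; simp [trIP]
    · exact (hpd Φ h).le
  exact coer_of_isSymmTr_of_inverse_formBound hw hsym hpos (apply_inverse_of_isUnit hU) (inverse_apply_of_isUnit hU) hB hform Ψ

end Trace

/-! ## §2. ★★ NODE 00's bond sector at def-Y's v4 letters: the lane's `hco` from row 17's clause + the (3.46)–(3.47) global form bound of `G(U₀)` -/

section Bond

variable {d ℓ : ℕ} {hd : 1 ≤ d + 1} {hL : Odd (ℓ + 1) ∧ 1 < ℓ + 1} {b₀ b₁ : ℝ}
variable (i : KIdx d ℓ hd hL b₀ b₁) {N : ℕ} {G : Subgroup (Matrix (Fin N) (Fin N) ℂ)ˣ}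

/-- ★★ **THE LANE's `hco` FROM PRINT's TWO STATEMENTS.**  At def-Y's v4 letters (`parSymY`, `parBY`, `G′ = GpY parSymY`), fibre `M_N(ℂ)`, `G ≤ U(N)` and a
`G`-valued background `U₀`: Theorem 3.11's clause `PosDefTr 1 (Δ_a(U₀))` (the N06 certificate's row 17 at `U₀`) and the global form bound of Theorem 3.3's (3.46)–(3.47)
for `G(U₀) = Δ_a(U₀)⁻¹`, `⟨Φ, G(U₀)Φ⟩₁ ≤ B·⟨Φ,Φ⟩₁` with `0 < B`, give the quantitative coercivity `B⁻¹·⟨Ψ,Ψ⟩₁ ≤ ⟨Ψ, Δ_a(U₀)Ψ⟩₁` — the lane's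
LOCATED-ASK `hco` with `m = B⁻¹`.  Symmetry of `Δ_a(U₀)` is the N06 lineage's `deltaAY_parSymY_isSymmTr` (by name); `G = GAY … = Ring.inverse (Δ_a)` by definition.
[cite: Balaban1985BackgroundPropagators, (3.26)–(3.27) p.395, (3.46)–(3.47) p.398, Thm 3.3 p.399, Thm 3.11 p.416; Balaban1984PropagatorsII, p.226] -/
theorem trIP_deltaAY_parSymY_ge_of_posDefTr_of_GAY_formBound (hG : G ≤ B7Prop2Explicit.unitaryUnits (Matrix (Fin N) (Fin N) ℂ))
    {U₀ : CfgY (Matrix (Fin N) (Fin N) ℂ) i} (hU : ∀ μ x, U₀ μ x ∈ G)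
    (hpd : PosDefTr (fun _ => (1 : ℝ)) (deltaAY i (parSymY i) (parBY i) (GpY i (parSymY i)) U₀))
    {B : ℝ} (hB : 0 < B)
    (hGB : ∀ Φ : FBondY i → Matrix (Fin N) (Fin N) ℂ,
      trIP (fun _ => (1 : ℝ)) Φ (GAY i (parSymY i) (parBY i) (GpY i (parSymY i)) U₀ Φ) ≤ B * trIP (fun _ => (1 : ℝ)) Φ Φ)
    (Ψ : FBondY i → Matrix (Fin N) (Fin N) ℂ) :
    B⁻¹ * trIP (fun _ => (1 : ℝ)) Ψ Ψ ≤ trIP (fun _ => (1 : ℝ)) Ψ (deltaAY i (parSymY i) (parBY i) (GpY i (parSymY i)) U₀ Ψ) :=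
  coer_of_isSymmTr_posDefTr_of_ringInverse_formBound (fun _ => one_pos) (deltaAY_parSymY_isSymmTr i hG hU) hpd hB hGB Ψ

end Bond

/-! ## §3. ★★★ The located G-junction along pv27's pencil with N06's content = Theorem 3.11's clause + Theorem 3.3's (3.46)–(3.47) for `G` -/

section Pencil

variable {d ℓ : ℕ} {hd : 1 ≤ d + 1} {hL : Odd (ℓ + 1) ∧ 1 < ℓ + 1} {b₀ b₁ : ℝ}
variable (i : KIdx d ℓ hd hL b₀ b₁) {N : ℕ} {G : Subgroup (Matrix (Fin N) (Fin N) ℂ)ˣ}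
variable {ν : ℕ} {Nf : Fin ν → ℕ} [∀ j, NeZero (Nf j)]

/-- ★★★ **THE LOCATED G-JUNCTION FROM ROW 17's CLAUSE AND (3.46)–(3.47).**  n10-w2 g3's `rawEntryLetters_toMatrix_GAY_prodCfg_located_of_coercive_flat` at the v4 letters,
its displayed quantitative coercivity `(m, hm, hco)` SUPPLIED by §2 with `m = B⁻¹`.  Inputs: Δ_a's pencil letters
`hA : RawEntryLetters (A′ ↦ toMatrix B′ B′ (Δ_a(e^{iηA′}U₀))) loc R ρ B_Δ` (the junction's own datum; `0 < R`, `0 < ρ`), `G ≤ U(N)`, a `G`-valued `U₀`,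
row 17's clause `PosDefTr 1 (Δ_a(U₀))`, the form bound `⟨Φ, G(U₀)Φ⟩₁ ≤ B·⟨Φ,Φ⟩₁` (`0 < B`), a fibre bound `m_F` of `loc`, and the Combes–Thomas window
`0 ≤ κ ≤ ρ∕4`, `8·B_Δ·κ·(m_F c₀(1,ρ∕2)^ν) ≤ B⁻¹·ρ`, `0 ≤ ρ′ < κ`.  Conclusion:
`RawEntryLetters (A′ ↦ toMatrix B′ B′ (G(e^{iηA′}U₀))) loc (R∕(4·B_Δ·(4B)·(m_F c₀(1,(κ−ρ′)∕3)^ν)² + 1)) ρ′ (2·(4B))` — located radius, rate and constant.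
[cite: Balaban1985BackgroundPropagators, (3.26)–(3.27) p.395, (3.46)–(3.47) p.398, Thm 3.3 p.399, Thm 3.4 p.400, (3.84)–(3.86) p.407, Thm 3.10 (3.108) p.416, Thm 3.11 p.416;
Balaban1984PropagatorsII, p.226, Lemma 2.1 (2.61) p.234; Balaban1988RG2Cluster, (2.5)–(2.7) pp.12–13; AizenmanWarzel2015, §10.3] -/
theorem rawEntryLetters_toMatrix_GAY_parSymY_prodCfg_located_of_posDefTr_of_formBound
    (hG : G ≤ B7Prop2Explicit.unitaryUnits (Matrix (Fin N) (Fin N) ℂ))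
    {U₀ : CfgY (Matrix (Fin N) (Fin N) ℂ) i} (hU : ∀ μ x, U₀ μ x ∈ G) (η : ℝ)
    {loc : FBondY i × (Fin N × Fin N) → UT Nf} {R ρ BΔ : ℝ}
    (hA : RawEntryLetters (fun a : Fin (d + 1) → Site (PV d ℓ i.m i.K hd hL) 0 → Matrix (Fin N) (Fin N) ℂ =>
      LinearMap.toMatrix
        ((Pi.basis fun _ : FBondY i => Matrix.stdBasis ℂ (Fin N) (Fin N)).reindex (Equiv.sigmaEquivProd (FBondY i) (Fin N × Fin N)))
        ((Pi.basis fun _ : FBondY i => Matrix.stdBasis ℂ (Fin N) (Fin N)).reindex (Equiv.sigmaEquivProd (FBondY i) (Fin N × Fin N)))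
        (deltaAY i (parSymY i) (parBY i) (GpY i (parSymY i)) (prodCfg U₀ η a))) loc R ρ BΔ)
    (hR : 0 < R) (hρ : 0 < ρ)
    -- N06's content: Theorem 3.11's clause (row 17) and Theorem 3.3's (3.46)–(3.47) for `G`, both at the one real background `U₀`
    (hpd : PosDefTr (fun _ => (1 : ℝ)) (deltaAY i (parSymY i) (parBY i) (GpY i (parSymY i)) U₀))
    {B : ℝ} (hB : 0 < B)
    (hGB : ∀ Φ : FBondY i → Matrix (Fin N) (Fin N) ℂ,
      trIP (fun _ => (1 : ℝ)) Φ (GAY i (parSymY i) (parBY i) (GpY i (parSymY i)) U₀ Φ) ≤ B * trIP (fun _ => (1 : ℝ)) Φ Φ)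
    {mF : ℕ} (hfib : ∀ y : UT Nf, (univ.filter fun k => loc k = y).card ≤ mF)
    {κ : ℝ} (hκ : 0 ≤ κ) (hκ4 : κ ≤ ρ / 4) (hκm : 8 * BΔ * κ * (mF * B6.c0 1 (ρ / 2) ^ ν) ≤ B⁻¹ * ρ)
    {ρ' : ℝ} (hρ'0 : 0 ≤ ρ') (hρ' : ρ' < κ) :
    RawEntryLetters (fun a : Fin (d + 1) → Site (PV d ℓ i.m i.K hd hL) 0 → Matrix (Fin N) (Fin N) ℂ =>
        LinearMap.toMatrix
          ((Pi.basis fun _ : FBondY i => Matrix.stdBasis ℂ (Fin N) (Fin N)).reindex (Equiv.sigmaEquivProd (FBondY i) (Fin N × Fin N)))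
          ((Pi.basis fun _ : FBondY i => Matrix.stdBasis ℂ (Fin N) (Fin N)).reindex (Equiv.sigmaEquivProd (FBondY i) (Fin N × Fin N)))
          (GAY i (parSymY i) (parBY i) (GpY i (parSymY i)) (prodCfg U₀ η a))) loc
      (R / (4 * (BΔ * (4 * B) * (mF * B6.c0 1 ((κ - ρ') / 3) ^ ν) * (mF * B6.c0 1 ((κ - ρ') / 3) ^ ν)) + 1)) ρ' (2 * (4 * B)) := by
  have h := rawEntryLetters_toMatrix_GAY_prodCfg_located_of_coercive_flat i (parSymY i) (parBY i) (GpY i (parSymY i)) U₀ η hA hR hρ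
    (inv_pos.mpr hB) (trIP_deltaAY_parSymY_ge_of_posDefTr_of_GAY_formBound i hG hU hpd hB hGB) hfib hκ hκ4 hκm hρ'0 hρ'
  simpa only [div_inv_eq_mul] using h

end Pencil

end Literature.MathematicalPhysics.QuantumFieldTheory.Balaban1983to89.B13CoerciveOfInverseFormBound

end
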